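import Mathlib
import Summits.CriticalPhenomena.CardyFormulaZ2.Theorems.CardyFlipRussoSquareFromVoronoiHubDefs
import Summits.CriticalPhenomena.CardyFormulaZ2.Theorems.CardyFlipRussoSquareFromVoronoiHubChessboardDefs
import Summits.CriticalPhenomena.CardyFormulaZ2.Theorems.CardyFlipRussoSquareFromVoronoiHubSmallCellsPart4
import Summits.CriticalPhenomena.CardyFormulaZ2.Theorems.CardyFlipRussoSquareFromVoronoiHubFaithfulPart1
import Literature.Probability.Percolation.VoronoiCrossing
import Literature.Probability.Percolation.PercolationEvents
import Literature.Probability.Percolation.TriHexLemma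
import Literature.Probability.Percolation.RSW
import Literature.Analysis.FunctionSpaces.PoissonPointProcess
import HarnessLib

/-!
# Stub `stub_endpointSandwich_of` (S7) of line `Sketch` (r2 k4, card `poissonised-chessboard`) — Part 1:
# measure-theoretic bookkeeping of the chessboard endpoint

Crux `Summit.CriticalPhenomena.CardyFormulaZ2.Theses.CardyFlipRusso.SquareFromVoronoiHub`
(stmt-CriticalPhenomena-6434), line `Sketch` (round 2, card `poissonised-chessboard`), registered stub
`stub_endpointSandwich_of` (S7, the lead's stub: the `u = 1` end of the leg is site percolation on
`G_s`).  This first part collects the probability-free-of-geometry inputs of the sandwich: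

* `measurableSet_crudeCrossing` — the crude `G_s` crossing event of a conformal rectangle is a
  measurable set of site configurations (it is determined by the finitely many sites of the window,
  `SmallCells.crudeCrossing_determinedBy`, and finitely determined events are measurable,
  `DeterminedBy.measurableSet_of_finset`);
* `legMeasure_real_coins` — the coin marginal of the leg law IS the crux's `sitePercolation _ half`
  (`Measure.prod_prod`);
* `blackNuclei_flip` / `whiteNuclei_flip` / `legMeasure_real_whiteCrossing` — the COLOUR-FLIP
  INVOLUTION `ω ↦ (((ω.1.1.2, ω.1.1.1), ω.1.2), ω.2ᶜ)` (free parts exchanged, coins complemented)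
  exchanges the two colour classes on the nose and preserves `legMeasure P P PK` (swap of the two
  equal free laws, `Measure.prod_swap`; complementation symmetry of fair site percolation,
  `sitePercolation_map_compl` with `symm_half`), so the annealed probability of a WHITE continuum
  crossing equals `legProb` — the duality input of the upper half of the sandwich;
* `smul_blackNuclei_eq` / `smul_whiteNuclei_eq` — on configurations without free nuclei, the plane
  nuclei `s • blackNuclei m ω` are the block-type plane nuclei whose `4.8.8` block (read at mesh
  `δ = s·m` through `blkUnit (p/δ)`) carries a black coin: the dictionary between the leg's colour
  classes and the abstract coloured nuclei of the deterministic stubs S3–S5.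

Sources: Bollobás–Riordan, *Percolation* (2006), Ch. 5 Lemma 7 (complementation symmetry at
`p = 1/2`), Ch. 8 §8.1 (two-coloured Voronoi tessellations, black/white duality).
-/

noncomputable section

open scoped Topology Pointwise
open Filter Set MeasureTheory Metric
open Literature.Analysis.FunctionSpaces (PointConfig IsPoissonPointProcess)
open Literature.Probability.RandomPlanarGeometry (ConformalRectangle)
open Literature.Probability.Percolation (SiteConfig sitePercolation half voronoiCrossing blackRegion
  DeterminedBy sitePercolation_map_compl symm_half)
open Summit.CriticalPhenomena.CardyFormulaZ2.Cruxes.SquareFromVoronoiHub.VoronoiBlocks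
  (zGs Gs crudeCrossing siteCrossingProb)
open Summit.CriticalPhenomena.CardyFormulaZ2.Cruxes.SquareFromVoronoiHub.VoronoiBlocks.Faithful
  (finite_setOf_dist_mul_zGs_le)

namespace Summit.CriticalPhenomena.CardyFormulaZ2.Cruxes.SquareFromVoronoiHub.PoissonisedChessboard

/-! ### Measurability of the crude crossing event -/

/-- **The crude `G_s` crossing event is measurable** in the site-configuration space: it is
determined by the finitely many sites `y` with `δ · zGs y ∈ Ω` (`Ω` is bounded), and an event
determined by finitely many coordinates is a finite union of cylinders. [folklore] -/
theorem measurableSet_crudeCrossing (R : ConformalRectangle) {δ : ℝ} (hδ : 0 < δ) :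
    MeasurableSet (crudeCrossing R δ) := by
  classical
  obtain ⟨ρ, hΩ⟩ := R.isBounded.subset_closedBall (0 : ℂ)
  have hWfin : {y : (ℤ × ℤ) ⊕ (ℤ × ℤ) | (δ : ℂ) * zGs y ∈ R.carrier}.Finite :=
    (finite_setOf_dist_mul_zGs_le hδ 0 ρ).subset fun y hy => by
      have := hΩ hy
      rwa [mem_closedBall, dist_comm] at this
  exact (VoronoiBlocks.SmallCells.crudeCrossing_determinedBy R δ hWfin.coe_toFinset).measurableSet_of_finset

/-! ### The coin marginal -/

/-- **The coin marginal of the leg law is the crux's fair site percolation on `G_s`**: for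
probability nucleus laws, the `legMeasure`-probability of an event depending on the coins only is
its `sitePercolation _ half`-probability (`Measure.prod_prod`, no measurability needed). [folklore] -/
theorem legMeasure_real_coins (PBf PWf PK : Measure (PointConfig ℂ)) [IsProbabilityMeasure PBf]
    [IsProbabilityMeasure PWf] [IsProbabilityMeasure PK] (D : Set (SiteConfig ((ℤ × ℤ) ⊕ (ℤ × ℤ)))) :
    (legMeasure PBf PWf PK).real {ω | ω.2 ∈ D} = (sitePercolation ((ℤ × ℤ) ⊕ (ℤ × ℤ)) half).real D := by
  have hD : {ω : LegConfig | ω.2 ∈ D} = (univ : Set ((PointConfig ℂ × PointConfig ℂ) × PointConfig ℂ)) ×ˢ D := by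
    ext ω
    simp
  rw [hD, measureReal_def, measureReal_def, legMeasure, Measure.prod_prod, measure_univ, one_mul]

/-! ### The colour-flip involution -/

/-- The black nuclei of the flipped configuration (free parts exchanged, coins complemented) are the
white nuclei of the original one. [folklore] -/
theorem blackNuclei_flip (m : ℝ) (ω : LegConfig) :
    blackNuclei m ((((ω.1.1.2, ω.1.1.1), ω.1.2), ω.2ᶜ) : LegConfig) = whiteNuclei m ω := by
  ext x
  simp [blackNuclei, whiteNuclei]

/-- The white nuclei of the flipped configuration are the black nuclei of the original one.
[folklore] -/
theorem whiteNuclei_flip (m : ℝ) (ω : LegConfig) :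
    whiteNuclei m ((((ω.1.1.2, ω.1.1.1), ω.1.2), ω.2ᶜ) : LegConfig) = blackNuclei m ω := by
  ext x
  simp [blackNuclei, whiteNuclei]

/-- **The colour flip preserves the leg law** when the two free laws coincide: as a map of measures,
`legMeasure P P PK` is invariant under `ω ↦ (((ω.1.1.2, ω.1.1.1), ω.1.2), ω.2ᶜ)` — swap of the two
equal free factors (`Measure.prod_swap`) and complementation symmetry of fair site percolation
(`sitePercolation_map_compl`, `symm_half`). [cite: BollobasRiordan2006, Ch. 5 Lemma 7] -/
theorem legMeasure_map_flip (P PK : Measure (PointConfig ℂ)) [SFinite P] [SFinite PK] :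
    (legMeasure P P PK).map
        ((MeasurableEquiv.prodCongr
          (MeasurableEquiv.prodCongr MeasurableEquiv.prodComm (MeasurableEquiv.refl (PointConfig ℂ)))
          (MeasurableEquiv.ofInvolutive (compl : SiteConfig ((ℤ × ℤ) ⊕ (ℤ × ℤ)) → _) compl_involutive
            measurable_compl) : LegConfig ≃ᵐ LegConfig)) =
      legMeasure P P PK := by
  have hfun : ((MeasurableEquiv.prodCongr
      (MeasurableEquiv.prodCongr MeasurableEquiv.prodComm (MeasurableEquiv.refl (PointConfig ℂ)))
      (MeasurableEquiv.ofInvolutive (compl : SiteConfig ((ℤ × ℤ) ⊕ (ℤ × ℤ)) → _) compl_involutive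
        measurable_compl) : LegConfig ≃ᵐ LegConfig) : LegConfig → LegConfig) =
      Prod.map (Prod.map Prod.swap id) compl := by
    funext ω
    rfl
  rw [hfun, legMeasure, ← Measure.map_prod_map _ _ (measurable_swap.prodMap measurable_id) measurable_compl,
    ← Measure.map_prod_map _ _ measurable_swap measurable_id, Measure.prod_swap, Measure.map_id,
    sitePercolation_map_compl, symm_half]

/-- **White crossings are as likely as black ones**: under `legMeasure P P PK` (equal free laws,
fair coins) the annealed probability that the conformal rectangle `R` has a WHITE continuum crossing
(the closed white region, roles of the colours exchanged in `voronoiCrossing`) equals `legProb`.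
The white event is the preimage of `legCrossing` under the colour flip, a measurable equivalence
preserving the law (`MeasurableEquiv.map_apply` is valid for every set, measurable or not).
[cite: BollobasRiordan2006, Ch. 8 §8.1] -/
theorem legMeasure_real_whiteCrossing (P PK : Measure (PointConfig ℂ)) [SFinite P] [SFinite PK]
    (R : ConformalRectangle) (m s : ℝ) :
    (legMeasure P P PK).real
        {ω | voronoiCrossing R.carrier (R.arc 0) (R.arc 2) s (whiteNuclei m ω) (blackNuclei m ω)} =
      legProb P P PK R m s := by
  set Φ : LegConfig ≃ᵐ LegConfig := MeasurableEquiv.prodCongr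
      (MeasurableEquiv.prodCongr MeasurableEquiv.prodComm (MeasurableEquiv.refl (PointConfig ℂ)))
      (MeasurableEquiv.ofInvolutive (compl : SiteConfig ((ℤ × ℤ) ⊕ (ℤ × ℤ)) → _) compl_involutive
        measurable_compl) with hΦ
  have hΦω : ∀ ω : LegConfig, Φ ω = ((((ω.1.1.2, ω.1.1.1), ω.1.2), ω.2ᶜ) : LegConfig) := fun ω => rfl
  have hpre : {ω : LegConfig | voronoiCrossing R.carrier (R.arc 0) (R.arc 2) s (whiteNuclei m ω)
      (blackNuclei m ω)} = Φ ⁻¹' legCrossing R m s := by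
    ext ω
    simp only [mem_preimage, legCrossing, mem_setOf_eq, hΦω, blackNuclei_flip, whiteNuclei_flip]
  rw [hpre, legProb, measureReal_def, measureReal_def, ← MeasurableEquiv.map_apply, hΦ,
    legMeasure_map_flip]

/-! ### The dictionary: plane nuclei of the leg vs. coin-coloured block-type nuclei -/

/-- Reading blocks at mesh `δ = s · m` in the plane is reading them at block side `m` in nucleus
units: `blkUnit ((s x) / δ) = blk m x`. [folklore] -/
theorem blkUnit_smul_div {m s δ : ℝ} (hs : s ≠ 0) (hm : m ≠ 0) (hδ : s * m = δ) (x : ℂ) :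
    blkUnit ((s : ℂ) * x / (δ : ℂ)) = blk m x := by
  unfold blk
  congr 1
  have hs' : (s : ℂ) ≠ 0 := by exact_mod_cast hs
  have hm' : (m : ℂ) ≠ 0 := by exact_mod_cast hm
  rw [← hδ]
  push_cast
  field_simp

/-- **Dictionary, black**: without free black nuclei, the plane black nuclei `s • blackNuclei m ω`
are the block-type plane nuclei `p ∈ s • ω.1.2` whose block at mesh `δ = s·m` carries a black coin.
[folklore] -/
theorem smul_blackNuclei_eq {m s δ : ℝ} (hs : s ≠ 0) (hm : m ≠ 0) (hδ : s * m = δ) {ω : LegConfig}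
    (h0 : (ω.1.1.1 : Set ℂ) = ∅) :
    (s : ℂ) • blackNuclei m ω = {p | p ∈ (s : ℂ) • (ω.1.2 : Set ℂ) ∧ blkUnit (p / (δ : ℂ)) ∈ ω.2} := by
  ext p
  simp only [blackNuclei, h0, empty_union, mem_smul_set, mem_setOf_eq, smul_eq_mul]
  constructor
  · rintro ⟨x, ⟨hx, hbx⟩, rfl⟩
    exact ⟨⟨x, hx, rfl⟩, by rwa [blkUnit_smul_div hs hm hδ]⟩
  · rintro ⟨⟨x, hx, rfl⟩, hb⟩
    exact ⟨x, ⟨hx, by rwa [blkUnit_smul_div hs hm hδ] at hb⟩, rfl⟩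

/-- **Dictionary, white**: without free white nuclei, the plane white nuclei `s • whiteNuclei m ω`
are the block-type plane nuclei whose block at mesh `δ = s·m` carries a white coin. [folklore] -/
theorem smul_whiteNuclei_eq {m s δ : ℝ} (hs : s ≠ 0) (hm : m ≠ 0) (hδ : s * m = δ) {ω : LegConfig}
    (h0 : (ω.1.1.2 : Set ℂ) = ∅) :
    (s : ℂ) • whiteNuclei m ω = {p | p ∈ (s : ℂ) • (ω.1.2 : Set ℂ) ∧ blkUnit (p / (δ : ℂ)) ∉ ω.2} := by
  ext p
  simp only [whiteNuclei, h0, empty_union, mem_smul_set, mem_setOf_eq, smul_eq_mul]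
  constructor
  · rintro ⟨x, ⟨hx, hbx⟩, rfl⟩
    exact ⟨⟨x, hx, rfl⟩, by rwa [blkUnit_smul_div hs hm hδ]⟩
  · rintro ⟨⟨x, hx, rfl⟩, hb⟩
    exact ⟨x, ⟨hx, by rwa [blkUnit_smul_div hs hm hδ] at hb⟩, rfl⟩

/-- **Registered sub-goal `stub_endpointSandwich_part1`** of S7 (carrier of this Part 1): white
continuum crossings are as likely as black ones under the leg law with equal free laws (the
statement of `legMeasure_real_whiteCrossing`). [cite: BollobasRiordan2006, Ch. 8 §8.1] -/
theorem stub_endpointSandwich_part1 : ∀ (P PK : Measure (PointConfig ℂ)) [SFinite P] [SFinite PK] (R : ConformalRectangle) (m s : ℝ),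
    (legMeasure P P PK).real
        {ω | voronoiCrossing R.carrier (R.arc 0) (R.arc 2) s (whiteNuclei m ω) (blackNuclei m ω)} =
      legProb P P PK R m s :=
  fun P PK _ _ R m s => legMeasure_real_whiteCrossing P PK R m s

end Summit.CriticalPhenomena.CardyFormulaZ2.Cruxes.SquareFromVoronoiHub.PoissonisedChessboard

end
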